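import Literature.Probability.RandomPlanarGeometry.SAWPulledBridgeFreeEnergyZdEnvelope
import HarnessLib

/-!
# The memory-THREE tilted transfer bound for the pulled-bridge free energy on `ℤ^{d+1}`:
# thirteen row inequalities for a potential on the reduced last-three-step states imply `λ_B(y) ≤ log ρ`

Topic `Literature/Probability/RandomPlanarGeometry` (continues `SAWPulledBridgeFreeEnergyZdEnvelope.lean` /
`SAWPulledBridgeFreeEnergyZdThirdOrderEnvelope.lean`: the memory-ONE transfer potential on the last-step types `{+e₀, lateral, −e₀}`
gave `e^{λ_B} ≤ y + 2d − 2d/y + 2d(2d+1)/y²`; the one-step extension calculus `sum_saws_succ_eq_sum_freeNbrs`, `unitSteps`, `nbrs`,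
`freeNbrs`, `extendTo` of `BDGS2012CountMonoExt.lean` / `SAWPulledLargeForceExpansionZdLinearRadius.lean`;
`pulledBridgeZ_eq_sum_bridges`, `pulledBridgeFreeEnergy_le_log_of_geometric`).

MEMORY THREE.  A self-avoiding walk never reverses a step and never closes a unit square: if its last three steps are
`a, b, c` then the next step `v` satisfies `v ≠ −c`, and `v ≠ −b` whenever `c = −a` (then the site `ω(n) − b = ω(n−3)` is
occupied).  The tilted walk (`+e₀ ↦ y`, lateral `↦ 1`, `−e₀ ↦ y⁻¹`) with exactly these two exclusions is a finite automaton; by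
the lateral symmetry of `ℤ^{d+1}` its state reduces to THIRTEEN classes (`MemThree.St`): the force types of the last two steps
`b, c ∈ {U = +e₀, L = lateral, D = −e₀}` (`UD`, `DU` excluded), the square flag `f = [c = −a]`, and for two lateral steps whether
`c = b` (`LLs`) or `c ⊥ b` (`LLp`, only in `d ≥ 2`):
`UU · LU0 · LU1 · UL0 · UL1 · DL0 · DL1 · LLs · LLp0 · LLp1 · LD0 · LD1 · DD`.
Its transfer operator (rows = current state, entries = weight × number of admissible next steps into each class) is

  `UU → y·UU + 2d·UL0`,                     `LU0 → y·UU + (2d−1)·UL0 + UL1`,        `LU1 → y·UU + (2d−1)·UL0`,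
  `UL0 → y·LU0 + y⁻¹·LD1 + LLs + (2d−2)·LLp0`,   `UL1 → y·LU0 + LLs + (2d−2)·LLp0`,
  `DL0 → y·LU1 + y⁻¹·LD0 + LLs + (2d−2)·LLp0`,   `DL1 → y⁻¹·LD0 + LLs + (2d−2)·LLp0`,
  `LLs → y·LU0 + y⁻¹·LD0 + LLs + (2d−2)·LLp0`,
  `LLp0 → y·LU0 + y⁻¹·LD0 + LLs + (2d−3)·LLp0 + LLp1`,   `LLp1 → y·LU0 + y⁻¹·LD0 + LLs + (2d−3)·LLp0`   (`d ≥ 2`),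
  `LD0 → y⁻¹·DD + (2d−1)·DL0 + DL1`,        `LD1 → y⁻¹·DD + (2d−1)·DL0`,            `DD → y⁻¹·DD + 2d·DL0`.

THE THEOREM.  If a positive potential `φ` on the thirteen states satisfies the thirteen row inequalities `(Mφ)_s ≤ ρ·φ(s)`
(`MemThree.Supersolution d y ρ φ`; the two `LLp` rows are only required when `2 ≤ d`), then the `φ`-weighted tilted sum over the
`n`-step self-avoiding walks grows at most like `ρⁿ` (`MemThree.sum_g1_le` = the thirteen rows, `MemThree.sum_freeNbrs_le` = the step
along a walk: self-avoidance only removes terms, and the two removed terms above are provably occupied; `MemThree.wsum_succ_le`,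
`MemThree.wsum_le_pow_mul`), hence **`MemThree.pulledBridgeFreeEnergy_le_log : λ_B(y) ≤ log ρ`** on `ℤ^{d+1}` for
every `d` (bridges are self-avoiding walks and `y^{span} ≤ y^{height}/min φ · φ`).  The every-`y` fifth-order envelope
`e^{λ_B} ≤ y + 2d − 2d/y + 2d(2d+1)/y² − 4d²(2d+3)/y³ + 2d(8d³+28d²+2d−1)/y⁴` is obtained from this theorem with an explicit
algebraic potential in `SAWPulledBridgeFreeEnergyZdFifthOrderEnvelope.lean`.

References: Madras–Slade 1993 §1.2 (walks with finite memory, eq. (1.2.12)–(1.2.14)); Janse van Rensburg–Whittington 2013 §3.2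
(the pulled walk, `λ(y) ≤ log μ_d + log y`); Beaton 2015 §3 (bridges, `Z^B_n(y)`).  The thirteen-state reduction and the
supersolution criterion for every `d` are, to our knowledge, not in print.  Provenance: lane «pcv-sawmu», a-p3 g27 (2026-08-28).
PURE STD, no data, no `decide`.
-/

noncomputable section

open Finset Filter Topology
open scoped BigOperators
open Literature.Probability.LatticeModels
open Literature.Probability.RandomPlanarGeometry.SAW

namespace Literature.Probability.RandomPlanarGeometry.SAW.Zd

namespace MemThree

variable {d : ℕ}

/-! ### The thirteen reduced states and the state of a walk -/

/-- The thirteen lateral-symmetry classes of the last three steps `(a, b, c)` of a self-avoiding walk on `ℤ^{d+1}`: force types of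
`b, c` (`U = +e₀`, `L` = lateral, `D = −e₀`), the square flag `[c = −a]` (suffix `1`), and for two lateral steps `c = b` (`LLs`)
versus `c ⊥ b` (`LLp`). [cite: MadrasSlade1993, §1.2, eq. (1.2.12)–(1.2.14)] -/
inductive St
  | UU | LU0 | LU1 | UL0 | UL1 | DL0 | DL1 | LLs | LLp0 | LLp1 | LD0 | LD1 | DD

/-- The class of the step pair `(b, c)` (previous step `b`, last step `c`) with square flag `f`; reversal configurations (`c = −b`),
which do not occur along a self-avoiding walk, are sent to `UU` / `DD`. [cite: MadrasSlade1993, §1.2, eq. (1.2.12)–(1.2.14)] -/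
def stateOf (b c : Site (d + 1)) (f : Bool) : St :=
  if c 0 = 1 then (if b 0 = 0 then (if f then St.LU1 else St.LU0) else St.UU)
  else if c 0 = -1 then (if b 0 = 0 then (if f then St.LD1 else St.LD0) else St.DD)
  else if b 0 = 1 then (if f then St.UL1 else St.UL0)
  else if b 0 = -1 then (if f then St.DL1 else St.DL0)
  else if c = b then St.LLs else (if f then St.LLp1 else St.LLp0)

/-- The state of a walk `ω` at time `n ≥ 2`: the classes of its steps `b = ω(n−1) − ω(n−2)`, `c = ω(n) − ω(n−1)` and the square
flag `[c = −(ω(n−2) − ω(n−3))]` (at `n = 2` the truncated subtraction makes the flag `[c = 0]`, i.e. `false`).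
[cite: MadrasSlade1993, §1.2, eq. (1.2.12)–(1.2.14)] -/
def stW (ω : ℕ → Site (d + 1)) (n : ℕ) : St :=
  stateOf (ω (n - 1) - ω (n - 2)) (ω n - ω (n - 1)) (decide (ω n - ω (n - 1) = -(ω (n - 2) - ω (n - 3))))

/-- **A memory-three supersolution at the value `ρ`**: a positive potential `φ` on the thirteen states whose one-step tilted
transfer sums are at most `ρ·φ` row by row (the two `LLp` rows only in `d ≥ 2`, where perpendicular lateral pairs exist).
[cite: MadrasSlade1993, §1.2, eq. (1.2.12)–(1.2.14)] -/
structure Supersolution (d : ℕ) (y ρ : ℝ) (φ : St → ℝ) : Prop where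
  pos : ∀ s, 0 < φ s
  rUU : y * φ .UU + 2 * d * φ .UL0 ≤ ρ * φ .UU
  rLU0 : y * φ .UU + (2 * d - 1) * φ .UL0 + φ .UL1 ≤ ρ * φ .LU0
  rLU1 : y * φ .UU + (2 * d - 1) * φ .UL0 ≤ ρ * φ .LU1
  rUL0 : y * φ .LU0 + y⁻¹ * φ .LD1 + φ .LLs + (2 * d - 2) * φ .LLp0 ≤ ρ * φ .UL0
  rUL1 : y * φ .LU0 + φ .LLs + (2 * d - 2) * φ .LLp0 ≤ ρ * φ .UL1
  rDL0 : y * φ .LU1 + y⁻¹ * φ .LD0 + φ .LLs + (2 * d - 2) * φ .LLp0 ≤ ρ * φ .DL0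
  rDL1 : y⁻¹ * φ .LD0 + φ .LLs + (2 * d - 2) * φ .LLp0 ≤ ρ * φ .DL1
  rLLs : y * φ .LU0 + y⁻¹ * φ .LD0 + φ .LLs + (2 * d - 2) * φ .LLp0 ≤ ρ * φ .LLs
  rLLp0 : 2 ≤ d → y * φ .LU0 + y⁻¹ * φ .LD0 + φ .LLs + (2 * d - 3) * φ .LLp0 + φ .LLp1 ≤ ρ * φ .LLp0
  rLLp1 : 2 ≤ d → y * φ .LU0 + y⁻¹ * φ .LD0 + φ .LLs + (2 * d - 3) * φ .LLp0 ≤ ρ * φ .LLp1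
  rLD0 : y⁻¹ * φ .DD + (2 * d - 1) * φ .DL0 + φ .DL1 ≤ ρ * φ .LD0
  rLD1 : y⁻¹ * φ .DD + (2 * d - 1) * φ .DL0 ≤ ρ * φ .LD1
  rDD : y⁻¹ * φ .DD + 2 * d * φ .DL0 ≤ ρ * φ .DD

/-! ### Unit steps: the force step `e₀`, its reverse, and the `2d` lateral steps -/

/-- The force direction `e₀`. [cite: MadrasSlade1993, §1.1] -/
def e0 : Site (d + 1) := Pi.single 0 1

/-- `e₀·e₀ = 1`. [cite: MadrasSlade1993, §1.1] -/
@[simp] theorem e0_zero : (e0 : Site (d + 1)) 0 = 1 := by simp [e0]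

/-- `(−e₀)·e₀ = −1`. [cite: MadrasSlade1993, §1.1] -/
@[simp] theorem neg_e0_zero : (-e0 : Site (d + 1)) 0 = -1 := by simp [e0]

/-- `e₀ ≠ −e₀`. [cite: MadrasSlade1993, §1.1] -/
theorem e0_ne_neg : (e0 : Site (d + 1)) ≠ -e0 := by
  intro h; have := congrFun h 0; simp [e0] at this

/-- The `2d` lateral unit steps `±e_k`, `k ≥ 1`, of `ℤ^{d+1}`. [cite: MadrasSlade1993, §1.1] -/
def latSteps (d : ℕ) : Finset (Site (d + 1)) :=
  (Finset.univ : Finset (Fin d × Bool)).image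
    fun kb => if kb.2 then Pi.single kb.1.succ 1 else -Pi.single kb.1.succ 1

/-- The parametrisation of the lateral steps is injective. [cite: MadrasSlade1993, §1.1] -/
private theorem lat_inj (d : ℕ) : Function.Injective
    (fun kb : Fin d × Bool => if kb.2 then (Pi.single kb.1.succ (1 : ℤ) : Site (d + 1)) else -Pi.single kb.1.succ 1) := by
  rintro ⟨k, b⟩ ⟨k', b'⟩ h
  have hk : k = k' := by
    by_contra hne
    have hne' : (k.succ : Fin (d + 1)) ≠ k'.succ := fun e => hne (Fin.succ_injective _ e)
    have := congrFun h k.succ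
    cases b <;> cases b' <;> simp [Pi.single_eq_of_ne hne'] at this
  subst hk
  cases b <;> cases b' <;> first | rfl | (exfalso; have := congrFun h k.succ; simp at this)

/-- There are `2d` lateral steps. [cite: MadrasSlade1993, §1.1] -/
theorem card_latSteps (d : ℕ) : (latSteps d).card = 2 * d := by
  rw [latSteps, Finset.card_image_of_injective _ (lat_inj d), Finset.card_univ, Fintype.card_prod, Fintype.card_fin,
    Fintype.card_bool, mul_comm]

/-- A lateral step has no force component. [cite: MadrasSlade1993, §1.1] -/
theorem apply_zero_of_mem_latSteps {v : Site (d + 1)} (hv : v ∈ latSteps d) : v 0 = 0 := by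
  simp only [latSteps, Finset.mem_image, Finset.mem_univ, true_and] at hv
  obtain ⟨⟨k, b⟩, rfl⟩ := hv
  cases b <;> simp

/-- Lateral steps are unit steps. [cite: MadrasSlade1993, §1.1] -/
theorem mem_unitSteps_of_mem_latSteps {v : Site (d + 1)} (hv : v ∈ latSteps d) : v ∈ unitSteps (d + 1) := by
  simp only [latSteps, Finset.mem_image, Finset.mem_univ, true_and] at hv
  obtain ⟨⟨k, b⟩, rfl⟩ := hv
  cases b
  · exact mem_unitSteps.2 ⟨k.succ, Or.inr (by simp)⟩
  · exact mem_unitSteps.2 ⟨k.succ, Or.inl (by simp)⟩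

/-- The reverse of a lateral step is lateral. [cite: MadrasSlade1993, §1.1] -/
theorem neg_mem_latSteps {v : Site (d + 1)} (hv : v ∈ latSteps d) : -v ∈ latSteps d := by
  simp only [latSteps, Finset.mem_image, Finset.mem_univ, true_and] at hv ⊢
  obtain ⟨⟨k, b⟩, rfl⟩ := hv
  cases b
  · exact ⟨⟨k, true⟩, by simp⟩
  · exact ⟨⟨k, false⟩, by simp⟩

/-- A unit step is `e₀`, `−e₀` or lateral. [cite: MadrasSlade1993, §1.1] -/
theorem trichotomy_of_mem_unitSteps {v : Site (d + 1)} (hv : v ∈ unitSteps (d + 1)) :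
    v = e0 ∨ v = -e0 ∨ v ∈ latSteps d := by
  obtain ⟨k, hk⟩ := mem_unitSteps.1 hv
  refine Fin.cases ?_ (fun j => ?_) k hk
  · rintro (rfl | rfl)
    · exact Or.inl rfl
    · exact Or.inr (Or.inl rfl)
  · rintro (rfl | rfl)
    · exact Or.inr (Or.inr (Finset.mem_image.2 ⟨⟨j, true⟩, Finset.mem_univ _, by simp⟩))
    · exact Or.inr (Or.inr (Finset.mem_image.2 ⟨⟨j, false⟩, Finset.mem_univ _, by simp⟩))

/-- `e₀` is not lateral. [cite: MadrasSlade1993, §1.1] -/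
theorem e0_not_mem_latSteps : (e0 : Site (d + 1)) ∉ latSteps d := fun h => by
  have := apply_zero_of_mem_latSteps h; simp at this

/-- `−e₀` is not lateral. [cite: MadrasSlade1993, §1.1] -/
theorem neg_e0_not_mem_latSteps : (-e0 : Site (d + 1)) ∉ latSteps d := fun h => by
  have := apply_zero_of_mem_latSteps h; simp at this

/-- The unit steps are `e₀`, `−e₀` and the lateral steps. [cite: MadrasSlade1993, §1.1] -/
theorem unitSteps_eq_insert : unitSteps (d + 1) = insert e0 (insert (-e0) (latSteps d)) := by
  ext v
  constructor
  · intro hv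
    rcases trichotomy_of_mem_unitSteps hv with rfl | rfl | h
    · exact Finset.mem_insert_self _ _
    · exact Finset.mem_insert_of_mem (Finset.mem_insert_self _ _)
    · exact Finset.mem_insert_of_mem (Finset.mem_insert_of_mem h)
  · intro hv
    rcases Finset.mem_insert.1 hv with rfl | hv
    · exact mem_unitSteps.2 ⟨0, Or.inl rfl⟩
    rcases Finset.mem_insert.1 hv with rfl | hv
    · exact mem_unitSteps.2 ⟨0, Or.inr rfl⟩
    · exact mem_unitSteps_of_mem_latSteps hv

/-- Splitting a sum over the unit steps into the force step, its reverse and the lateral steps. [cite: MadrasSlade1993, §1.1] -/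
theorem sum_unitSteps_eq (F : Site (d + 1) → ℝ) :
    ∑ v ∈ unitSteps (d + 1), F v = F e0 + F (-e0) + ∑ v ∈ latSteps d, F v := by
  rw [unitSteps_eq_insert, Finset.sum_insert, Finset.sum_insert neg_e0_not_mem_latSteps, add_assoc]
  rw [Finset.mem_insert, not_or]
  exact ⟨e0_ne_neg, e0_not_mem_latSteps⟩

/-- A lateral sum which is constant. [cite: MadrasSlade1993, §1.1] -/
theorem sum_latSteps_const {F : Site (d + 1) → ℝ} {a : ℝ} (h : ∀ v ∈ latSteps d, F v = a) :
    ∑ v ∈ latSteps d, F v = 2 * d * a := by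
  rw [Finset.sum_congr rfl h, Finset.sum_const, card_latSteps, nsmul_eq_mul]; push_cast; ring

/-- A lateral sum which is constant off one lateral step `w`. [cite: MadrasSlade1993, §1.1] -/
theorem sum_latSteps_one {F : Site (d + 1) → ℝ} {a : ℝ} {w : Site (d + 1)} (hw : w ∈ latSteps d)
    (h : ∀ v ∈ latSteps d, v ≠ w → F v = a) :
    ∑ v ∈ latSteps d, F v = F w + (2 * d - 1) * a := by
  rw [← Finset.add_sum_erase _ _ hw]
  have : ∑ v ∈ (latSteps d).erase w, F v = ∑ _v ∈ (latSteps d).erase w, a :=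
    Finset.sum_congr rfl fun v hv => h v (Finset.mem_of_mem_erase hv) (Finset.ne_of_mem_erase hv)
  rw [this, Finset.sum_const, Finset.card_erase_of_mem hw, card_latSteps, nsmul_eq_mul]
  have hd : 1 ≤ 2 * d := by
    have : 0 < (latSteps d).card := Finset.card_pos.2 ⟨w, hw⟩
    rw [card_latSteps] at this; omega
  push_cast [Nat.cast_sub hd]; ring

/-- A lateral sum which is constant off two distinct lateral steps `w₁, w₂`. [cite: MadrasSlade1993, §1.1] -/
theorem sum_latSteps_two {F : Site (d + 1) → ℝ} {a : ℝ} {w₁ w₂ : Site (d + 1)} (hw₁ : w₁ ∈ latSteps d)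
    (hw₂ : w₂ ∈ latSteps d) (hne : w₁ ≠ w₂) (h : ∀ v ∈ latSteps d, v ≠ w₁ → v ≠ w₂ → F v = a) :
    ∑ v ∈ latSteps d, F v = F w₁ + F w₂ + (2 * d - 2) * a := by
  have hw₂' : w₂ ∈ (latSteps d).erase w₁ := Finset.mem_erase.2 ⟨hne.symm, hw₂⟩
  rw [← Finset.add_sum_erase _ _ hw₁, ← Finset.add_sum_erase _ _ hw₂']
  have : ∑ v ∈ ((latSteps d).erase w₁).erase w₂, F v = ∑ _v ∈ ((latSteps d).erase w₁).erase w₂, a :=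
    Finset.sum_congr rfl fun v hv =>
      h v (Finset.mem_of_mem_erase (Finset.mem_of_mem_erase hv))
        (Finset.ne_of_mem_erase (Finset.mem_of_mem_erase hv)) (Finset.ne_of_mem_erase hv)
  rw [this, Finset.sum_const, Finset.card_erase_of_mem hw₂', Finset.card_erase_of_mem hw₁, card_latSteps, nsmul_eq_mul]
  have hd : 2 ≤ 2 * d := by
    have : 1 < (latSteps d).card := Finset.one_lt_card.2 ⟨w₁, hw₁, w₂, hw₂, hne⟩
    rw [card_latSteps] at this; omega
  have : ((2 * d - 1 - 1 : ℕ) : ℝ) = 2 * d - 2 := by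
    rw [Nat.sub_sub, Nat.cast_sub hd]; push_cast; ring
  rw [this]; ring

/-- Two lateral steps on different axes force `d ≥ 2`. [cite: MadrasSlade1993, §1.1] -/
theorem two_le_of_lat_ne {b c : Site (d + 1)} (hb : b ∈ latSteps d) (hc : c ∈ latSteps d) (h1 : c ≠ b) (h2 : c ≠ -b) :
    2 ≤ d := by
  simp only [latSteps, Finset.mem_image, Finset.mem_univ, true_and] at hb hc
  obtain ⟨⟨k, β⟩, rfl⟩ := hb
  obtain ⟨⟨k', β'⟩, rfl⟩ := hc
  have hk : k ≠ k' := by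
    rintro rfl
    cases β <;> cases β' <;> simp at h1 h2
  have : 1 < Fintype.card (Fin d) := Fintype.one_lt_card_iff.2 ⟨k, k', hk⟩
  rwa [Fintype.card_fin] at this

/-- A lateral sum which is constant off three distinct lateral steps. [cite: MadrasSlade1993, §1.1] -/
theorem sum_latSteps_three {F : Site (d + 1) → ℝ} {a : ℝ} {w₁ w₂ w₃ : Site (d + 1)} (hw₁ : w₁ ∈ latSteps d)
    (hw₂ : w₂ ∈ latSteps d) (hw₃ : w₃ ∈ latSteps d) (h12 : w₁ ≠ w₂) (h13 : w₁ ≠ w₃) (h23 : w₂ ≠ w₃)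
    (h : ∀ v ∈ latSteps d, v ≠ w₁ → v ≠ w₂ → v ≠ w₃ → F v = a) :
    ∑ v ∈ latSteps d, F v = F w₁ + F w₂ + F w₃ + (2 * d - 3) * a := by
  have hw₂' : w₂ ∈ (latSteps d).erase w₁ := Finset.mem_erase.2 ⟨h12.symm, hw₂⟩
  have hw₃' : w₃ ∈ ((latSteps d).erase w₁).erase w₂ := Finset.mem_erase.2 ⟨h23.symm, Finset.mem_erase.2 ⟨h13.symm, hw₃⟩⟩
  rw [← Finset.add_sum_erase _ _ hw₁, ← Finset.add_sum_erase _ _ hw₂', ← Finset.add_sum_erase _ _ hw₃']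
  have : ∑ v ∈ (((latSteps d).erase w₁).erase w₂).erase w₃, F v = ∑ _v ∈ (((latSteps d).erase w₁).erase w₂).erase w₃, a :=
    Finset.sum_congr rfl fun v hv => by
      have h3 := Finset.ne_of_mem_erase hv
      have hv2 := Finset.mem_of_mem_erase hv
      have h2 := Finset.ne_of_mem_erase hv2
      have hv1 := Finset.mem_of_mem_erase hv2
      exact h v (Finset.mem_of_mem_erase hv1) (Finset.ne_of_mem_erase hv1) h2 h3
  rw [this, Finset.sum_const, Finset.card_erase_of_mem hw₃', Finset.card_erase_of_mem hw₂', Finset.card_erase_of_mem hw₁,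
    card_latSteps, nsmul_eq_mul]
  have hd : 3 ≤ 2 * d := by
    have : 2 < (latSteps d).card := Finset.two_lt_card.2 ⟨w₁, hw₁, w₂, hw₂, w₃, hw₃, h12, h13, h23⟩
    rw [card_latSteps] at this; omega
  have : ((2 * d - 1 - 1 - 1 : ℕ) : ℝ) = 2 * d - 3 := by
    rw [Nat.sub_sub, Nat.sub_sub, Nat.cast_sub hd]; push_cast; ring
  rw [this]; ring

/-- Sites with different force components are different. [cite: MadrasSlade1993, §1.1] -/
theorem ne_of_apply_zero_ne {v w : Site (d + 1)} (h : v 0 ≠ w 0) : v ≠ w := fun e => h (by rw [e])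

/-- A lateral step is not its own reverse. [cite: MadrasSlade1993, §1.1] -/
theorem ne_neg_of_mem_latSteps {v : Site (d + 1)} (hv : v ∈ latSteps d) : v ≠ -v := by
  simp only [latSteps, Finset.mem_image, Finset.mem_univ, true_and] at hv
  obtain ⟨⟨k, b⟩, rfl⟩ := hv
  intro h
  have := congrFun h k.succ
  cases b <;> simp at this

/-! ### Values of `stateOf` -/

section stateOf_values
variable (b c : Site (d + 1)) (f : Bool)

/-- `UU`. [cite: MadrasSlade1993, §1.1] -/
theorem stateOf_UU (hb : b 0 = 1) (hc : c 0 = 1) : stateOf b c f = .UU := by simp [stateOf, hb, hc]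
/-- `LU`. [cite: MadrasSlade1993, §1.1] -/
theorem stateOf_LU (hb : b 0 = 0) (hc : c 0 = 1) : stateOf b c f = if f then .LU1 else .LU0 := by simp [stateOf, hb, hc]
/-- `DD`. [cite: MadrasSlade1993, §1.1] -/
theorem stateOf_DD (hb : b 0 = -1) (hc : c 0 = -1) : stateOf b c f = .DD := by simp [stateOf, hb, hc]
/-- `LD`. [cite: MadrasSlade1993, §1.1] -/
theorem stateOf_LD (hb : b 0 = 0) (hc : c 0 = -1) : stateOf b c f = if f then .LD1 else .LD0 := by simp [stateOf, hb, hc]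
/-- `UL`. [cite: MadrasSlade1993, §1.1] -/
theorem stateOf_UL (hb : b 0 = 1) (hc : c 0 = 0) : stateOf b c f = if f then .UL1 else .UL0 := by simp [stateOf, hb, hc]
/-- `DL`. [cite: MadrasSlade1993, §1.1] -/
theorem stateOf_DL (hb : b 0 = -1) (hc : c 0 = 0) : stateOf b c f = if f then .DL1 else .DL0 := by simp [stateOf, hb, hc]
/-- `LLs`. [cite: MadrasSlade1993, §1.1] -/
theorem stateOf_LLs (hb : b 0 = 0) (hcb : c = b) : stateOf b c f = .LLs := by
  subst hcb; simp [stateOf, hb]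
/-- `LLp`. [cite: MadrasSlade1993, §1.1] -/
theorem stateOf_LLp (hb : b 0 = 0) (hc : c 0 = 0) (hcb : c ≠ b) : stateOf b c f = if f then .LLp1 else .LLp0 := by
  simp [stateOf, hb, hc, hcb]

end stateOf_values

/-! ### The one-step potential sum with the two exclusions -/

/-- The tilted potential of the step `v` taken after the steps `(b, c)`, set to `0` for the reversal `v = −c` and, when the square
flag is set, for the square-closing step `v = −b`. [cite: MadrasSlade1993, §1.2, eq. (1.2.12)–(1.2.14)] -/
def g1 (y : ℝ) (φ : St → ℝ) (b c : Site (d + 1)) (f : Bool) (v : Site (d + 1)) : ℝ :=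
  if v ≠ -c ∧ (f = true → v ≠ -b) then y ^ (v 0) * φ (stateOf c v (decide (v = -b))) else 0

/-- `g1 ≥ 0` for a positive potential and `y > 0`. [cite: MadrasSlade1993, §1.1] -/
theorem g1_nonneg {y : ℝ} (hy : 0 < y) {φ : St → ℝ} (hφ : ∀ s, 0 < φ s) (b c : Site (d + 1)) (f : Bool)
    (v : Site (d + 1)) : 0 ≤ g1 y φ b c f v := by
  unfold g1; split_ifs
  · exact mul_nonneg (zpow_pos hy _).le (hφ _).le
  · exact le_rfl

/-- ★★ **The thirteen rows**: for unit steps `b, c` with `c ≠ −b` and any flag, the exclusion-respecting one-step potential sum is at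
most `ρ·φ(state)` — the supersolution inequalities row by row, the admissible next steps of each class being counted exactly.
[cite: MadrasSlade1993, §1.2, eq. (1.2.12)–(1.2.14)] -/
theorem sum_g1_le {y ρ : ℝ} {φ : St → ℝ} (h : Supersolution d y ρ φ) {b c : Site (d + 1)}
    (hb : b ∈ unitSteps (d + 1)) (hc : c ∈ unitSteps (d + 1)) (hbc : c ≠ -b) (f : Bool) :
    ∑ v ∈ unitSteps (d + 1), g1 y φ b c f v ≤ ρ * φ (stateOf b c f) := by
  have hφ := h.pos
  rw [sum_unitSteps_eq]
  rcases trichotomy_of_mem_unitSteps hc with rfl | rfl | hcl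
  · ----------------------------------------------------------------- c = e₀ (last step up)
    have hD : g1 y φ b (e0 : Site (d + 1)) f (-e0) = 0 := by simp [g1]
    rcases trichotomy_of_mem_unitSteps hb with rfl | rfl | hbl
    · -- b = e₀ : state UU
      have hU : g1 y φ (e0 : Site (d + 1)) e0 f e0 = y * φ .UU := by
        simp [g1, e0_ne_neg, stateOf]
      have hL : ∑ v ∈ latSteps d, g1 y φ (e0 : Site (d + 1)) e0 f v = 2 * d * φ .UL0 :=
        sum_latSteps_const fun v hv => by
          have hv0 := apply_zero_of_mem_latSteps hv
          have h1 : v ≠ -e0 := ne_of_apply_zero_ne (by rw [hv0, neg_e0_zero]; norm_num)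
          simp [g1, h1, stateOf, hv0]
      rw [hU, hD, hL, stateOf_UU _ _ _ e0_zero e0_zero]
      linarith [h.rUU]
    · exact absurd (neg_neg _).symm hbc
    · -- b lateral : state LU
      have hb0 := apply_zero_of_mem_latSteps hbl
      have hnb := neg_mem_latSteps hbl
      have hnb0 := apply_zero_of_mem_latSteps hnb
      have hU : g1 y φ b (e0 : Site (d + 1)) f e0 = y * φ .UU := by
        have h1 : (e0 : Site (d + 1)) ≠ -b := ne_of_apply_zero_ne (by rw [hnb0, e0_zero]; norm_num)
        simp [g1, e0_ne_neg, h1, stateOf]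
      have hL : ∑ v ∈ latSteps d, g1 y φ b (e0 : Site (d + 1)) f v = g1 y φ b e0 f (-b) + (2 * d - 1) * φ .UL0 :=
        sum_latSteps_one hnb fun v hv hvb => by
          have hv0 := apply_zero_of_mem_latSteps hv
          have h1 : v ≠ -e0 := ne_of_apply_zero_ne (by rw [hv0, neg_e0_zero]; norm_num)
          simp [g1, h1, hvb, stateOf, hv0]
      have hB : g1 y φ b (e0 : Site (d + 1)) f (-b) = if f then 0 else φ .UL1 := by
        have h1 : -b ≠ -(e0 : Site (d + 1)) := ne_of_apply_zero_ne (by rw [hnb0, neg_e0_zero]; norm_num)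
        cases f <;> simp [g1, h1, stateOf, hnb0]
      rw [hU, hD, hL, hB, stateOf_LU _ _ _ hb0 e0_zero]
      cases f
      · simp only [if_false, Bool.false_eq_true]; linarith [h.rLU0]
      · simp only [if_true]; linarith [h.rLU1]
  · ----------------------------------------------------------------- c = −e₀ (last step down)
    have hU : g1 y φ b (-e0 : Site (d + 1)) f e0 = 0 := by simp [g1]
    rcases trichotomy_of_mem_unitSteps hb with rfl | rfl | hbl
    · exact absurd rfl hbc
    · -- b = −e₀ : state DD
      have hD : g1 y φ (-e0 : Site (d + 1)) (-e0) f (-e0) = y⁻¹ * φ .DD := by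
        have h1 : -(e0 : Site (d + 1)) ≠ e0 := fun e => e0_ne_neg e.symm
        simp [g1, h1, stateOf]
      have hL : ∑ v ∈ latSteps d, g1 y φ (-e0 : Site (d + 1)) (-e0) f v = 2 * d * φ .DL0 :=
        sum_latSteps_const fun v hv => by
          have hv0 := apply_zero_of_mem_latSteps hv
          have h1 : v ≠ (e0 : Site (d + 1)) := ne_of_apply_zero_ne (by rw [hv0, e0_zero]; norm_num)
          simp [g1, h1, stateOf, hv0]
      rw [hU, hD, hL, stateOf_DD _ _ _ neg_e0_zero neg_e0_zero]
      linarith [h.rDD]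
    · -- b lateral : state LD
      have hb0 := apply_zero_of_mem_latSteps hbl
      have hnb := neg_mem_latSteps hbl
      have hnb0 := apply_zero_of_mem_latSteps hnb
      have hD : g1 y φ b (-e0 : Site (d + 1)) f (-e0) = y⁻¹ * φ .DD := by
        have h1 : -(e0 : Site (d + 1)) ≠ e0 := fun e => e0_ne_neg e.symm
        have h2 : -(e0 : Site (d + 1)) ≠ -b := ne_of_apply_zero_ne (by rw [hnb0, neg_e0_zero]; norm_num)
        simp [g1, h1, h2, stateOf]
      have hL : ∑ v ∈ latSteps d, g1 y φ b (-e0 : Site (d + 1)) f v = g1 y φ b (-e0) f (-b) + (2 * d - 1) * φ .DL0 :=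
        sum_latSteps_one hnb fun v hv hvb => by
          have hv0 := apply_zero_of_mem_latSteps hv
          have h1 : v ≠ (e0 : Site (d + 1)) := ne_of_apply_zero_ne (by rw [hv0, e0_zero]; norm_num)
          simp [g1, h1, hvb, stateOf, hv0]
      have hB : g1 y φ b (-e0 : Site (d + 1)) f (-b) = if f then 0 else φ .DL1 := by
        have h1 : -b ≠ (e0 : Site (d + 1)) := ne_of_apply_zero_ne (by rw [hnb0, e0_zero]; norm_num)
        cases f <;> simp [g1, h1, stateOf, hnb0]
      rw [hU, hD, hL, hB, stateOf_LD _ _ _ hb0 neg_e0_zero]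
      cases f
      · simp only [if_false, Bool.false_eq_true]; linarith [h.rLD0]
      · simp only [if_true]; linarith [h.rLD1]
  · ----------------------------------------------------------------- c lateral
    have hc0 := apply_zero_of_mem_latSteps hcl
    have hnc := neg_mem_latSteps hcl
    have hnc0 := apply_zero_of_mem_latSteps hnc
    have hcnc : c ≠ -c := ne_neg_of_mem_latSteps hcl
    have hUc : (e0 : Site (d + 1)) ≠ -c := ne_of_apply_zero_ne (by rw [hnc0, e0_zero]; norm_num)
    have hDc : -(e0 : Site (d + 1)) ≠ -c := ne_of_apply_zero_ne (by rw [hnc0, neg_e0_zero]; norm_num)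
    rcases trichotomy_of_mem_unitSteps hb with rfl | rfl | hbl
    · -- b = e₀ : state UL
      have hU : g1 y φ (e0 : Site (d + 1)) c f e0 = y * φ .LU0 := by
        simp [g1, hUc, e0_ne_neg, stateOf, hc0]
      have hD : g1 y φ (e0 : Site (d + 1)) c f (-e0) = if f then 0 else y⁻¹ * φ .LD1 := by
        cases f <;> simp [g1, hDc, stateOf, hc0]
      have hL : ∑ v ∈ latSteps d, g1 y φ (e0 : Site (d + 1)) c f v =
          g1 y φ e0 c f c + g1 y φ e0 c f (-c) + (2 * d - 2) * φ .LLp0 :=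
        sum_latSteps_two hcl hnc hcnc fun v hv hvc hvnc => by
          have hv0 := apply_zero_of_mem_latSteps hv
          have h1 : v ≠ -e0 := ne_of_apply_zero_ne (by rw [hv0, neg_e0_zero]; norm_num)
          simp [g1, h1, hvnc, hvc, stateOf, hv0, hc0]
      have hC : g1 y φ (e0 : Site (d + 1)) c f c = φ .LLs := by
        have h1 : c ≠ -e0 := ne_of_apply_zero_ne (by rw [hc0, neg_e0_zero]; norm_num)
        simp [g1, hcnc, h1, stateOf, hc0]
      have hN : g1 y φ (e0 : Site (d + 1)) c f (-c) = 0 := by simp [g1]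
      rw [hU, hD, hL, hC, hN, stateOf_UL _ _ _ e0_zero hc0]
      cases f
      · simp only [if_false, Bool.false_eq_true]; linarith [h.rUL0]
      · simp only [if_true]; linarith [h.rUL1]
    · -- b = −e₀ : state DL
      have hU : g1 y φ (-e0 : Site (d + 1)) c f e0 = if f then 0 else y * φ .LU1 := by
        cases f <;> simp [g1, hUc, stateOf, hc0]
      have hD : g1 y φ (-e0 : Site (d + 1)) c f (-e0) = y⁻¹ * φ .LD0 := by
        have h1 : -(e0 : Site (d + 1)) ≠ e0 := fun e => e0_ne_neg e.symm
        simp [g1, hDc, h1, stateOf, hc0]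
      have hL : ∑ v ∈ latSteps d, g1 y φ (-e0 : Site (d + 1)) c f v =
          g1 y φ (-e0) c f c + g1 y φ (-e0) c f (-c) + (2 * d - 2) * φ .LLp0 :=
        sum_latSteps_two hcl hnc hcnc fun v hv hvc hvnc => by
          have hv0 := apply_zero_of_mem_latSteps hv
          have h1 : v ≠ (e0 : Site (d + 1)) := ne_of_apply_zero_ne (by rw [hv0, e0_zero]; norm_num)
          simp [g1, h1, hvnc, hvc, stateOf, hv0, hc0]
      have hC : g1 y φ (-e0 : Site (d + 1)) c f c = φ .LLs := by
        have h1 : c ≠ (e0 : Site (d + 1)) := ne_of_apply_zero_ne (by rw [hc0, e0_zero]; norm_num)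
        simp [g1, hcnc, h1, stateOf, hc0]
      have hN : g1 y φ (-e0 : Site (d + 1)) c f (-c) = 0 := by simp [g1]
      rw [hU, hD, hL, hC, hN, stateOf_DL _ _ _ neg_e0_zero hc0]
      cases f
      · simp only [if_false, Bool.false_eq_true]; linarith [h.rDL0]
      · simp only [if_true]; linarith [h.rDL1]
    · -- b lateral : states LLs / LLp
      have hb0 := apply_zero_of_mem_latSteps hbl
      have hnb := neg_mem_latSteps hbl
      have hnb0 := apply_zero_of_mem_latSteps hnb
      have hU : g1 y φ b c f e0 = y * φ .LU0 := by
        have h1 : (e0 : Site (d + 1)) ≠ -b := ne_of_apply_zero_ne (by rw [hnb0, e0_zero]; norm_num)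
        simp [g1, hUc, h1, stateOf, hc0]
      have hD : g1 y φ b c f (-e0) = y⁻¹ * φ .LD0 := by
        have h1 : -(e0 : Site (d + 1)) ≠ -b := ne_of_apply_zero_ne (by rw [hnb0, neg_e0_zero]; norm_num)
        simp [g1, hDc, h1, stateOf, hc0]
      have hN : g1 y φ b c f (-c) = 0 := by simp [g1]
      by_cases hcb : c = b
      · -- c = b : state LLs
        subst hcb
        have hL : ∑ v ∈ latSteps d, g1 y φ c c f v = g1 y φ c c f c + g1 y φ c c f (-c) + (2 * d - 2) * φ .LLp0 :=
          sum_latSteps_two hcl hnc hcnc fun v hv hvc hvnc => by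
            have hv0 := apply_zero_of_mem_latSteps hv
            simp [g1, hvnc, hvc, stateOf, hv0, hc0]
        have hC : g1 y φ c c f c = φ .LLs := by simp [g1, hcnc, stateOf, hc0]
        rw [hU, hD, hL, hC, hN, stateOf_LLs _ _ _ hc0 rfl]
        linarith [h.rLLs]
      · -- c ⊥ b : state LLp, `d ≥ 2`
        have hd2 : 2 ≤ d := two_le_of_lat_ne hbl hcl hcb hbc
        have hncb : -c ≠ -b := fun e => hcb (neg_injective e)
        have hL : ∑ v ∈ latSteps d, g1 y φ b c f v =
            g1 y φ b c f c + g1 y φ b c f (-c) + g1 y φ b c f (-b) + (2 * d - 3) * φ .LLp0 :=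
          sum_latSteps_three hcl hnc hnb hcnc hbc hncb fun v hv hvc hvnc hvnb => by
            have hv0 := apply_zero_of_mem_latSteps hv
            simp [g1, hvnc, hvc, hvnb, stateOf, hv0, hc0]
        have hC : g1 y φ b c f c = φ .LLs := by simp [g1, hcnc, hbc, stateOf, hc0]
        have hB : g1 y φ b c f (-b) = if f then 0 else φ .LLp1 := by
          have h1 : -b ≠ c := fun e => hbc e.symm
          cases f <;> simp [g1, hncb.symm, h1, stateOf, hnb0, hc0]
        rw [hU, hD, hL, hC, hN, hB, stateOf_LLp _ _ _ hb0 hc0 hcb]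
        cases f
        · simp only [if_false, Bool.false_eq_true]; linarith [h.rLLp0 hd2]
        · simp only [if_true]; linarith [h.rLLp1 hd2]

/-! ### The step inequality along a self-avoiding walk -/

/-- A step of a nearest-neighbour walk is a unit step. [cite: MadrasSlade1993, §1.1] -/
theorem sub_mem_unitSteps_of_adj {x z : Site (d + 1)} (h : (zdGraph (d + 1)).Adj x z) : z - x ∈ unitSteps (d + 1) := by
  obtain ⟨i, hi | hi⟩ := (zdGraph_adj_iff_sub x z).1 h
  · exact mem_unitSteps.2 ⟨i, Or.inl hi⟩
  · exact mem_unitSteps.2 ⟨i, Or.inr (by rw [← neg_sub, hi])⟩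

/-- ★★ **The memory-three step**: for an `n`-step self-avoiding walk `ω` (`n ≥ 2`) on `ℤ^{d+1}` and a supersolution `φ` at `ρ`, the
`φ`-weighted tilted weight of the free one-step extensions of `ω` is at most `ρ` times the `φ`-weighted tilted weight of `ω`: the
reversed last step is occupied, and when the square flag is set so is `ω(n) − b = ω(n−3)`.
[cite: MadrasSlade1993, §1.2, eq. (1.2.12)–(1.2.14)] -/
theorem sum_freeNbrs_le {y ρ : ℝ} {φ : St → ℝ} (h : Supersolution d y ρ φ) (hy : 0 < y) {n : ℕ} (hn : 2 ≤ n)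
    {ω : ℕ → Site (d + 1)} (hω : ω ∈ saws (d + 1) n) :
    ∑ y' ∈ freeNbrs ω n, y ^ (y' 0) * φ (stW (extendTo ω n y') (n + 1)) ≤ ρ * (y ^ (ω n 0) * φ (stW ω n)) := by
  classical
  obtain ⟨-, -, hadj, hinj⟩ := mem_saws.1 hω
  have hφ := h.pos
  -- the last two steps
  have hac : (zdGraph (d + 1)).Adj (ω (n - 1)) (ω n) := by
    have := hadj (n - 1) (by omega); rwa [show n - 1 + 1 = n by omega] at this
  have hab : (zdGraph (d + 1)).Adj (ω (n - 2)) (ω (n - 1)) := by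
    have := hadj (n - 2) (by omega); rwa [show n - 2 + 1 = n - 1 by omega] at this
  have hc := sub_mem_unitSteps_of_adj hac
  have hb := sub_mem_unitSteps_of_adj hab
  have hbc : ω n - ω (n - 1) ≠ -(ω (n - 1) - ω (n - 2)) := by
    intro e
    have heq : ω n = ω (n - 2) := by
      funext i; have := congrFun e i; simp only [Pi.sub_apply, Pi.neg_apply] at this; linarith
    have := hinj (show n ∈ {i | i ≤ n} from Set.mem_setOf.2 le_rfl) (show n - 2 ∈ {i | i ≤ n} from Set.mem_setOf.2 (Nat.sub_le n 2)) heq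
    omega
  -- the state of a one-step extension
  have hst : ∀ y' : Site (d + 1), stW (extendTo ω n y') (n + 1) =
      stateOf (ω n - ω (n - 1)) (y' - ω n) (decide (y' - ω n = -(ω (n - 1) - ω (n - 2)))) := by
    intro y'
    have e2 : n + 1 - 2 = n - 1 := by omega
    have e3 : n + 1 - 3 = n - 2 := by omega
    simp only [stW, Nat.add_sub_cancel, e2, e3, extendTo_of_lt (Nat.lt_succ_self n), extendTo_of_le (le_refl n),
      extendTo_of_le (Nat.sub_le n 1), extendTo_of_le (Nat.sub_le n 2)]
  -- termwise identification on the free extensions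
  have hfree : ∀ y' ∈ freeNbrs ω n, y ^ (y' 0) * φ (stW (extendTo ω n y') (n + 1)) =
      y ^ (ω n 0) * g1 y φ (ω (n - 1) - ω (n - 2)) (ω n - ω (n - 1))
        (decide (ω n - ω (n - 1) = -(ω (n - 2) - ω (n - 3)))) (y' - ω n) := by
    intro y' hy'
    obtain ⟨-, hnot⟩ := mem_freeNbrs.1 hy'
    have hv1 : y' - ω n ≠ -(ω n - ω (n - 1)) := by
      intro e
      refine hnot (n - 1) (Nat.sub_le n 1) ?_
      funext i; have := congrFun e i; simp only [Pi.sub_apply, Pi.neg_apply] at this; linarith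
    have hv2 : decide (ω n - ω (n - 1) = -(ω (n - 2) - ω (n - 3))) = true → y' - ω n ≠ -(ω (n - 1) - ω (n - 2)) := by
      intro hf e
      have hf' := of_decide_eq_true hf
      refine hnot (n - 3) (Nat.sub_le n 3) ?_
      funext i
      have h1 := congrFun e i; have h2 := congrFun hf' i
      simp only [Pi.sub_apply, Pi.neg_apply] at h1 h2; linarith
    rw [hst, g1, if_pos ⟨hv1, hv2⟩, ← mul_assoc, ← zpow_add₀ hy.ne', Pi.sub_apply, add_sub_cancel]
  have hsub : freeNbrs ω n ⊆ nbrs (ω n) := Finset.filter_subset _ _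
  calc ∑ y' ∈ freeNbrs ω n, y ^ (y' 0) * φ (stW (extendTo ω n y') (n + 1))
      = ∑ y' ∈ freeNbrs ω n, y ^ (ω n 0) * g1 y φ (ω (n - 1) - ω (n - 2)) (ω n - ω (n - 1))
          (decide (ω n - ω (n - 1) = -(ω (n - 2) - ω (n - 3)))) (y' - ω n) := Finset.sum_congr rfl hfree
    _ ≤ ∑ y' ∈ nbrs (ω n), y ^ (ω n 0) * g1 y φ (ω (n - 1) - ω (n - 2)) (ω n - ω (n - 1))
          (decide (ω n - ω (n - 1) = -(ω (n - 2) - ω (n - 3)))) (y' - ω n) :=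
        Finset.sum_le_sum_of_subset_of_nonneg hsub fun y' _ _ =>
          mul_nonneg (zpow_pos hy _).le (g1_nonneg hy hφ _ _ _ _)
    _ = y ^ (ω n 0) * ∑ v ∈ unitSteps (d + 1), g1 y φ (ω (n - 1) - ω (n - 2)) (ω n - ω (n - 1))
          (decide (ω n - ω (n - 1) = -(ω (n - 2) - ω (n - 3)))) v := by
        rw [nbrs, Finset.sum_image (add_right_injective (ω n)).injOn, Finset.mul_sum]
        refine Finset.sum_congr rfl fun v _ => ?_
        rw [add_sub_cancel_left]
    _ ≤ y ^ (ω n 0) * (ρ * φ (stateOf (ω (n - 1) - ω (n - 2)) (ω n - ω (n - 1))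
          (decide (ω n - ω (n - 1) = -(ω (n - 2) - ω (n - 3)))))) :=
        mul_le_mul_of_nonneg_left (sum_g1_le h hb hc hbc _) (zpow_pos hy _).le
    _ = ρ * (y ^ (ω n 0) * φ (stW ω n)) := by simp only [stW]; ring

/-! ### The `φ`-weighted tilted sum over self-avoiding walks grows at most like `ρⁿ` -/

/-- The `φ`-weighted tilted sum over the `n`-step self-avoiding walks of `ℤ^{d+1}`: `Σ_ω y^{ω(n)·e₀} φ(state of ω at n)`.
[cite: JansevanRensburgWhittington2013, §3.2 eq. (3.12)–(3.13) (arXiv v4 p. 9)] -/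
def wsum (d : ℕ) (y : ℝ) (φ : St → ℝ) (n : ℕ) : ℝ :=
  ∑ ω ∈ saws (d + 1) n, y ^ (ω n 0) * φ (stW ω n)

/-- `wsum ≥ 0`. [cite: MadrasSlade1993, §1.1] -/
theorem wsum_nonneg (d : ℕ) {y : ℝ} (hy : 0 < y) {φ : St → ℝ} (hφ : ∀ s, 0 < φ s) (n : ℕ) : 0 ≤ wsum d y φ n :=
  Finset.sum_nonneg fun _ _ => mul_nonneg (zpow_pos hy _).le (hφ _).le

/-- ★★ **One step of the transfer bound**: `wsum (n+1) ≤ ρ · wsum n` for `n ≥ 2`. [cite: MadrasSlade1993, §1.2, eq. (1.2.12)–(1.2.14)] -/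
theorem wsum_succ_le {y ρ : ℝ} {φ : St → ℝ} (h : Supersolution d y ρ φ) (hy : 0 < y) {n : ℕ} (hn : 2 ≤ n) :
    wsum d y φ (n + 1) ≤ ρ * wsum d y φ n := by
  unfold wsum
  rw [sum_saws_succ_eq_sum_freeNbrs, Finset.mul_sum]
  refine Finset.sum_le_sum fun ω hω => ?_
  simp only [extendTo_of_lt (Nat.lt_succ_self n)]
  exact sum_freeNbrs_le h hy hn hω

/-- **`wsum (k+2) ≤ ρᵏ · wsum 2`**. [cite: MadrasSlade1993, §1.2, eq. (1.2.12)–(1.2.14)] -/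
theorem wsum_le_pow_mul {y ρ : ℝ} {φ : St → ℝ} (h : Supersolution d y ρ φ) (hy : 0 < y) (hρ : 0 ≤ ρ) :
    ∀ k : ℕ, wsum d y φ (k + 2) ≤ ρ ^ k * wsum d y φ 2
  | 0 => by simp
  | k + 1 => by
    calc wsum d y φ (k + 1 + 2) = wsum d y φ (k + 2 + 1) := by ring_nf
      _ ≤ ρ * wsum d y φ (k + 2) := wsum_succ_le h hy (by omega)
      _ ≤ ρ * (ρ ^ k * wsum d y φ 2) := mul_le_mul_of_nonneg_left (wsum_le_pow_mul h hy hρ k) hρ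
      _ = ρ ^ (k + 1) * wsum d y φ 2 := by ring

/-! ### From the transfer bound to the free energy -/

/-- The smallest of the thirteen potential values. [cite: MadrasSlade1993, §1.1] -/
def minPot (φ : St → ℝ) : ℝ :=
  min (φ .UU) (min (φ .LU0) (min (φ .LU1) (min (φ .UL0) (min (φ .UL1) (min (φ .DL0) (min (φ .DL1)
    (min (φ .LLs) (min (φ .LLp0) (min (φ .LLp1) (min (φ .LD0) (min (φ .LD1) (φ .DD))))))))))))
set_option maxHeartbeats 400000 in
/-- `minPot φ ≤ φ s`. [cite: MadrasSlade1993, §1.1] -/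
theorem minPot_le (φ : St → ℝ) : ∀ s, minPot φ ≤ φ s := by
  intro s; cases s <;> simp [minPot]

/-- `minPot φ > 0` for a positive potential. [cite: MadrasSlade1993, §1.1] -/
theorem minPot_pos {φ : St → ℝ} (hφ : ∀ s, 0 < φ s) : 0 < minPot φ := by
  simp only [minPot, lt_min_iff]; exact ⟨hφ _, hφ _, hφ _, hφ _, hφ _, hφ _, hφ _, hφ _, hφ _, hφ _, hφ _, hφ _, hφ _⟩

/-- **Bridges**: `Z^B_N(y) ≤ (minPot φ)⁻¹ · wsum N` for `N ≥ 1` (bridges are self-avoiding walks with non-negative final height;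
`y^{span} ≤ y^{height} φ / min φ`). [cite: Beaton2015, §3 (bridges, Z^B_n)] -/
theorem pulledBridgeZ_le_wsum {y : ℝ} (hy : 0 < y) {φ : St → ℝ} (hφ : ∀ s, 0 < φ s) {N : ℕ} (hN : 1 ≤ N) :
    pulledBridgeZ (d + 1) N y ≤ (minPot φ)⁻¹ * wsum d y φ N := by
  classical
  have hm := minPot_pos hφ
  rw [pulledBridgeZ_eq_sum_bridges, wsum, Finset.mul_sum]
  have hsub : bridges (d + 1) N ⊆ saws (d + 1) N := fun ω hω => (mem_bridges.1 hω).1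
  have hterm : ∀ ω ∈ bridges (d + 1) N,
      y ^ (ω N 0).toNat ≤ (minPot φ)⁻¹ * (y ^ (ω N 0) * φ (stW ω N)) := by
    intro ω hω
    obtain ⟨hs, hbr⟩ := mem_bridges.1 hω
    have hnn : 0 ≤ ω N 0 := by
      have := (hbr N (by omega) le_rfl).1
      rw [(mem_saws.1 hs).1, Pi.zero_apply] at this
      exact this.le
    rw [← zpow_natCast, Int.toNat_of_nonneg hnn, ← mul_assoc]
    have hP : 0 < y ^ (ω N 0) := zpow_pos hy _
    calc y ^ (ω N 0) = (minPot φ)⁻¹ * y ^ (ω N 0) * minPot φ := by field_simp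
      _ ≤ (minPot φ)⁻¹ * y ^ (ω N 0) * φ (stW ω N) := mul_le_mul_of_nonneg_left (minPot_le φ _) (by positivity)
  calc ∑ ω ∈ bridges (d + 1) N, y ^ (ω N 0).toNat
      ≤ ∑ ω ∈ bridges (d + 1) N, (minPot φ)⁻¹ * (y ^ (ω N 0) * φ (stW ω N)) := Finset.sum_le_sum hterm
    _ ≤ ∑ ω ∈ saws (d + 1) N, (minPot φ)⁻¹ * (y ^ (ω N 0) * φ (stW ω N)) :=
        Finset.sum_le_sum_of_subset_of_nonneg hsub fun ω _ _ =>
          mul_nonneg (inv_pos.2 hm).le (mul_nonneg (zpow_pos hy _).le (hφ _).le)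

/-- ★★★ **THE MEMORY-THREE TRANSFER BOUND**: if a positive potential `φ` on the thirteen reduced states is a supersolution at
`ρ > 0` of the tilted memory-three transfer operator on `ℤ^{d+1}` (`Supersolution d y ρ φ`, `y > 0`), then the pulled-bridge free
energy satisfies **`λ_B(y) ≤ log ρ`** — for every `d`. [cite: MadrasSlade1993, §1.2, eq. (1.2.12)–(1.2.14)]
[cite: JansevanRensburgWhittington2013, §3.2 eq. (3.12)–(3.13) and Theorem 8 (arXiv v4 pp. 9, 11)] -/
theorem pulledBridgeFreeEnergy_le_log {y ρ : ℝ} {φ : St → ℝ} (h : Supersolution d y ρ φ) (hy : 0 < y) (hρ : 0 < ρ) :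
    pulledBridgeFreeEnergy (d + 1) y ≤ Real.log ρ := by
  have hφ := h.pos
  have hm := minPot_pos hφ
  set A : ℝ := (minPot φ)⁻¹ * wsum d y φ 2 / ρ ^ 2 with hA
  set C : ℝ := max 1 (max A (max (pulledBridgeZ (d + 1) 0 y) (pulledBridgeZ (d + 1) 1 y / ρ))) with hC
  have hC0 : 0 < C := lt_of_lt_of_le one_pos (le_max_left _ _)
  refine pulledBridgeFreeEnergy_le_log_of_geometric d hy hC0 hρ fun N => ?_
  match N with
  | 0 =>
    rw [pow_zero, mul_one]
    exact le_trans (le_max_left _ _) (le_trans (le_max_right _ _) (le_max_right _ _))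
  | 1 =>
    have h1 : pulledBridgeZ (d + 1) 1 y = pulledBridgeZ (d + 1) 1 y / ρ * ρ ^ 1 := by field_simp
    rw [h1]
    refine mul_le_mul_of_nonneg_right ?_ (pow_nonneg hρ.le 1)
    exact le_trans (le_max_right _ _) (le_trans (le_max_right _ _) (le_max_right _ _))
  | N + 2 =>
    have hw := wsum_le_pow_mul h hy hρ.le N
    calc pulledBridgeZ (d + 1) (N + 2) y ≤ (minPot φ)⁻¹ * wsum d y φ (N + 2) := pulledBridgeZ_le_wsum hy hφ (by omega)
      _ ≤ (minPot φ)⁻¹ * (ρ ^ N * wsum d y φ 2) := mul_le_mul_of_nonneg_left hw (inv_pos.2 hm).le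
      _ = A * ρ ^ (N + 2) := by rw [hA]; field_simp; ring
      _ ≤ C * ρ ^ (N + 2) :=
        mul_le_mul_of_nonneg_right (le_trans (le_max_left _ _) (le_max_right _ _)) (pow_nonneg hρ.le _)

/-- The exponential form: **`e^{λ_B(y)} ≤ ρ`**. [cite: JansevanRensburgWhittington2013, §3.2 Theorem 8 (arXiv v4 p. 11)] -/
theorem exp_pulledBridgeFreeEnergy_le {y ρ : ℝ} {φ : St → ℝ} (h : Supersolution d y ρ φ) (hy : 0 < y) (hρ : 0 < ρ) :
    Real.exp (pulledBridgeFreeEnergy (d + 1) y) ≤ ρ := by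
  have := Real.exp_le_exp.2 (pulledBridgeFreeEnergy_le_log h hy hρ)
  rwa [Real.exp_log hρ] at this

end MemThree

end Literature.Probability.RandomPlanarGeometry.SAW.Zd
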